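import Summits.QuantumFields.YangMills.Theses.HyperbolicRegulator
import Summits.QuantumFields.YangMills.Theorems.HyperbolicToTorus.Negative.InteriorChartDegree

/-!
# Route `HyperbolicRegulator`, crux `HyperbolicToTorus` (stmt-QuantumFields-15827): vocabulary of the line
# `no_admissible_complex` (the crux AS TYPED holds vacuously — no admissible hyperbolic complex at large curvature scale)

Route-posited objects (D-0016 `<Route><Crux>Defs` file) shared by the registered stubs of the skeleton
`Cruxes/HyperbolicToTorus/Lines/no_admissible_complex.lean` (v3, lead `prover-line-stmt-QuantumFields-15827-0`) and by the
stub files that prove them. NOTHING here is asserted about the route: the file contains definitions, their one-line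
destructuring lemmas, and (at the end) the proof of the registered counting stub `stub_germCount`.

The crux `Summit.QuantumFields.YangMills.Theses.HyperbolicRegulator.HyperbolicToTorus` is `∀ family, H1 → H2 → T` where H1
says the family of finite square complexes is ADMISSIBLE (`(Fam …).1`, here `Adm`) for all curvature scales `k ≥ 8` and all
separation indices `j`. The line shows that `Adm k j …` is unsatisfiable at a fixed large `k` (double counting of the first
flat shell `{v ∈ V | dist v c = k/4 + 1}` around a cone `c`: `≤ 50` by axis rigidity of the flat charts, `≥ k/4 − 1` by a
row/column separation count in one chart), whence the crux holds by instantiating H1 there.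

* §1 `Adm` (verbatim the crux's inlined admissibility predicate), `graphOf`, `degOf`, `conesOf`, `IsFlatAt`, `IsDeepAt`,
  `ConeFrame`, `sphereCard` — unchanged from the registered skeleton v2 (crux-strategist, 2026-08-17).
* §2 `ℤ²`-chart vocabulary: `InBox`, `UnitStep`, `IsChart` (an injective box chart of radius `R` of a graph on `ℕ` whose
  interior points have as neighbours exactly their four chart neighbours), `ChartTracking` (walks from the centre are followed
  inside the chart for `min(length, R)` steps), `IsOpposite` / `opp` / `straightIter` (the intrinsic "neighbour of `b` opposite
  to `a`" and the walk that keeps going straight), `rotBy` (the rotation of `ℤ²` taking `(1,0)` to a unit vector `d`), `nbrs`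
  (the neighbour finset read off the edge list), `germSet` (the ≤ 50 candidates for the first flat shell around a
  cone), `OppRigid` (opposite-neighbour rigidity of a chart); the counting stubs take `IsChart`/`ChartTracking` at flat
  vertices and `OppRigid` of charts as hypotheses, each discharged by its own stub.
* §3 Destructuring lemmas: the nine axioms of `Adm` in the vocabulary of §1–§2 (definitional unfolding only), `nbrs` versus
  `graphOf`-adjacency, and `degOf_chart_ne_five` — the landed `Negative.card_edgesAt_ne_five_of_boxChart` (p148625) instantiated
  from `Adm` (a cone is never an interior chart point).

References: the route file `Theses/HyperbolicRegulator.lean` (rev 2) for the vocabulary; `Cruxes/HyperbolicToTorus/PICKED.md`,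
`Lines/no_admissible_complex.md` and `STRATEGY-CENSUS.md` for the line. Combinatorics is folklore (square complexes /
combinatorial curvature); no published theorem is restated here.
-/

set_option autoImplicit false

noncomputable section

namespace Summit.QuantumFields.YangMills.Cruxes.HyperbolicToTorus.NoAdmissibleComplex

open Finset

/-! ## §1 The admissibility predicate and its `G`-free pieces, verbatim the crux's `let`s

(`Adm`, `graphOf`, `degOf`, `conesOf`, `IsFlatAt`, `IsDeepAt`, `ConeFrame`, `sphereCard` are byte for byte those of the
registered skeleton `Cruxes/HyperbolicToTorus/Lines/no_admissible_complex.lean` v2.) -/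

/-- ADMISSIBILITY of one finite square complex at curvature scale `k` and separation index `j` — VERBATIM the first
component `(Fam k j V E Q σ τ bd cV cE).1` of the crux's inlined vocabulary (byte for byte the `Adm` of
`Cruxes/CurvatureAnchor/Lines/birth.lean`): graph/square axioms, degrees 4 or 5 with #squares = degree, every edge in
two squares, cones `k`-dense and `k`-separated, Poincaré inequality `10⁶k²`, two deep points at distance `≥ j`, flat
`ℤ²`-charts of sup-radius `k/4` at every vertex farther than `k/4` from all cones. -/
def Adm (k j : ℕ) (V E Q : Finset ℕ) (σ τ : ℕ → ℕ) (bd : ℕ → Fin 4 → ℕ × Bool) (cV : ℕ → ℤ × ℤ → ℕ)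
    (cE : ℕ → ℤ × ℤ → Fin 2 → ℕ × Bool) : Prop :=
  let st := fun e : ℕ × Bool => if e.2 then σ e.1 else τ e.1; let en := fun e : ℕ × Bool => if e.2 then τ e.1 else σ e.1; let Γ := SimpleGraph.fromRel fun a b : ℕ => ∃ e ∈ E, σ e = a ∧ τ e = b; let dg := fun x : ℕ => (E.filter fun e => σ e = x ∨ τ e = x).card; let K := V.filter fun x => dg x = 5; let F := fun x : ℕ => x ∈ V ∧ ∀ c ∈ K, k / 4 < Γ.dist x c; let Dp := fun x : ℕ => x ∈ V ∧ ∀ c ∈ K, k / 2 < Γ.dist x c; let ib := fun a : ℤ × ℤ => |a.1| ≤ (k : ℤ) / 4 ∧ |a.2| ≤ (k : ℤ) / 4; let nx := fun (a : ℤ × ℤ) (μ : Fin 2) => if μ = 0 then (a.1 + 1, a.2) else (a.1, a.2 + 1); (∀ e ∈ E, σ e ∈ V ∧ τ e ∈ V ∧ σ e ≠ τ e) ∧ (∀ q ∈ Q, (∀ i, (bd q i).1 ∈ E) ∧ (∀ i, en (bd q i) = st (bd q (i + 1))) ∧ (st ∘ bd q).Injective) ∧ (∀ e ∈ E, (Q.filter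 fun q => ∃ i, (bd q i).1 = e).card = 2) ∧ (∀ x ∈ V, (dg x = 4 ∨ dg x = 5) ∧ (Q.filter fun q => ∃ i, st (bd q i) = x).card = dg x) ∧ (∀ x ∈ V, ∃ c ∈ K, Γ.dist x c ≤ k) ∧ (∀ c ∈ K, ∀ c' ∈ K, c ≠ c' → k ≤ Γ.dist c c') ∧ (∀ f : ℕ → ℝ, ∑ x ∈ V, f x = 0 → ∑ x ∈ V, f x ^ 2 ≤ 10 ^ 6 * (k : ℝ) ^ 2 * ∑ e ∈ E, (f (σ e) - f (τ e)) ^ 2) ∧ (∃ x y, Dp x ∧ Dp y ∧ j ≤ Γ.dist x y) ∧ (∀ x, F x → cV x (0, 0) = x ∧ (∀ a, ib a → cV x a ∈ V) ∧ Set.InjOn (cV x) {a | ib a} ∧ (∀ a μ, ib a → ib (nx a μ) → (cE x a μ).1 ∈ E ∧ st (cE x a μ) = cV x a ∧ en (cE x a μ) = cV x (nx a μ)) ∧ (∀ a, ib a → ib (a.1 + 1, a.2 + 1) → ∃ q ∈ Q, Finset.univ.image (Prod.fst ∘ bd q) = {(cE x a 0).1, (cE x (nx a 0) 1).1, (cE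 x (nx a 1) 0).1, (cE x a 1).1}))

/-- The graph `Γ` of the complex (verbatim the crux's `let Γ`). -/
def graphOf (E : Finset ℕ) (σ τ : ℕ → ℕ) : SimpleGraph ℕ :=
  SimpleGraph.fromRel fun a b : ℕ => ∃ e ∈ E, σ e = a ∧ τ e = b

/-- The edge count `dg x` at a vertex (verbatim the crux's `let dg`). -/
def degOf (E : Finset ℕ) (σ τ : ℕ → ℕ) (x : ℕ) : ℕ :=
  (E.filter fun e => σ e = x ∨ τ e = x).card

/-- The cones `K` = vertices of degree 5 (verbatim the crux's `let K`). -/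
def conesOf (V E : Finset ℕ) (σ τ : ℕ → ℕ) : Finset ℕ :=
  V.filter fun x => degOf E σ τ x = 5

/-- FLAT vertex (verbatim the crux's `let F`): farther than `k/4` from every cone. -/
def IsFlatAt (k : ℕ) (V E : Finset ℕ) (σ τ : ℕ → ℕ) (x : ℕ) : Prop :=
  x ∈ V ∧ ∀ c ∈ conesOf V E σ τ, k / 4 < (graphOf E σ τ).dist x c

/-- DEEP vertex (verbatim the crux's `let Dp`): farther than `k/2` from every cone. -/
def IsDeepAt (k : ℕ) (V E : Finset ℕ) (σ τ : ℕ → ℕ) (x : ℕ) : Prop :=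
  x ∈ V ∧ ∀ c ∈ conesOf V E σ τ, k / 2 < (graphOf E σ τ).dist x c

/-- **Cone frame**: `c` is a cone, `x` is a flat vertex at graph distance exactly `k/4 + 1` from `c`, and `x` lies on
a geodesic from `c` to a deep vertex `p` (so the geodesic continues at least `k/4` steps beyond `x`, away from `c`). -/
def ConeFrame (k : ℕ) (V E : Finset ℕ) (σ τ : ℕ → ℕ) (c x : ℕ) : Prop :=
  c ∈ conesOf V E σ τ ∧ IsFlatAt k V E σ τ x ∧ (graphOf E σ τ).dist x c = k / 4 + 1 ∧
    ∃ p : ℕ, IsDeepAt k V E σ τ p ∧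
      (graphOf E σ τ).dist c p = (graphOf E σ τ).dist c x + (graphOf E σ τ).dist x p

/-- **The sphere of radius `k/4 + 1` about `c`, counted**: the number of vertices of `V` at graph distance exactly
`k/4 + 1` from `c` (the first shell of flat vertices around a cone). -/
def sphereCard (k : ℕ) (V E : Finset ℕ) (σ τ : ℕ → ℕ) (c : ℕ) : ℕ :=
  (V.filter fun v => (graphOf E σ τ).dist v c = k / 4 + 1).card


/-! ## §2 `ℤ²`-charts of a graph on `ℕ` -/

/-- `a` lies in the sup-norm box of radius `R`: `|a.1| ≤ R ∧ |a.2| ≤ R` (the crux's `ib` is `InBox ((k:ℤ)/4)`). -/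
def InBox (R : ℤ) (a : ℤ × ℤ) : Prop := |a.1| ≤ R ∧ |a.2| ≤ R

/-- `b` is one of the four lattice neighbours `a ± e₁`, `a ± e₂` of `a`. -/
def UnitStep (a b : ℤ × ℤ) : Prop :=
  b = (a.1 + 1, a.2) ∨ b = (a.1 - 1, a.2) ∨ b = (a.1, a.2 + 1) ∨ b = (a.1, a.2 - 1)

/-- **Chart of radius `R`** of the graph `Γ` (on vertex type `ℕ`): `ψ : ℤ² → ℕ` is injective on the box of radius `R`,
lattice neighbours inside the box are adjacent in `Γ`, and every INTERIOR point (`InBox (R-1)`) is *certified*: its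
`Γ`-neighbours are images of lattice neighbours (hence exactly the four chart neighbours). For an admissible complex the
vertex chart `cV x` at a flat vertex `x` is such a chart (`ChartsOfAdm`; interior points have degree `4` by
`Negative.card_edgesAt_ne_five_of_boxChart`; stub `stub_chart`). -/
def IsChart (Γ : SimpleGraph ℕ) (R : ℤ) (ψ : ℤ × ℤ → ℕ) : Prop :=
  Set.InjOn ψ {a | InBox R a} ∧
    (∀ a b : ℤ × ℤ, InBox R a → InBox R b → UnitStep a b → Γ.Adj (ψ a) (ψ b)) ∧
      ∀ a : ℤ × ℤ, InBox (R - 1) a → ∀ w : ℕ, Γ.Adj (ψ a) w → ∃ b : ℤ × ℤ, UnitStep a b ∧ w = ψ b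

/-- **Tracking** of walks inside a chart: every walk `W` of `Γ` starting at the centre `ψ (0,0)` is, for its first
`min (W.length, R)` steps, the image of a lattice path `P` from `(0,0)` with unit steps; in particular its `i`-th vertex is
`ψ (P i)` with `‖P i‖₁ ≤ i`. (Consequence of `IsChart` for `R ≥ 0`: stub `stub_tracking`.) -/
def ChartTracking (Γ : SimpleGraph ℕ) (R : ℤ) (ψ : ℤ × ℤ → ℕ) : Prop :=
  ∀ (x₀ u : ℕ) (W : Γ.Walk x₀ u), x₀ = ψ (0, 0) →
    ∃ P : ℕ → ℤ × ℤ, P 0 = (0, 0) ∧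
      (∀ i : ℕ, i < W.length → (i : ℤ) < R → UnitStep (P i) (P (i + 1))) ∧
        ∀ i : ℕ, i ≤ W.length → (i : ℤ) ≤ R → W.getVert i = ψ (P i) ∧ |(P i).1| + |(P i).2| ≤ i

/-- **The neighbour of `b` opposite to `a`**, intrinsically in `Γ`: `u` is adjacent to `b`, differs from `a`, and shares
no neighbour with `a` other than `b`. Inside a chart, for `a = ψ (q + e₁)`, `b = ψ q` this singles out `u = ψ (q - e₁)`
(`OppRigid`): the two perpendicular neighbours `ψ (q ± e₂)` share the neighbour `ψ (q + e₁ ± e₂)` with `a`. -/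
def IsOpposite (Γ : SimpleGraph ℕ) (a b u : ℕ) : Prop :=
  Γ.Adj b u ∧ u ≠ a ∧ ∀ z : ℕ, Γ.Adj u z → Γ.Adj z a → z = b

open Classical in
/-- Some neighbour of `b` opposite to `a` if there is one (junk value `0` otherwise); meaningful where `OppositeRigidity`
is available (`OppRigid` makes the opposite neighbour unique). -/
def opp (Γ : SimpleGraph ℕ) (a b : ℕ) : ℕ :=
  if h : ∃ u, IsOpposite Γ a b u then h.choose else 0

/-- **Going straight**: starting from the ordered pair `(a, b)` of consecutive vertices, step `i` times to the opposite
neighbour — `straightIter Γ (i+1) p = (b', opp Γ a' b')` where `(a', b') = straightIter Γ i p`. Along a chart axis this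
reproduces the axis (`OppRigid`), which is how a shell vertex is re-grown from its germ at the cone. -/
def straightIter (Γ : SimpleGraph ℕ) : ℕ → ℕ × ℕ → ℕ × ℕ
  | 0, p => p
  | i + 1, p => ((straightIter Γ i p).2, opp Γ (straightIter Γ i p).1 (straightIter Γ i p).2)

/-- Rotation of `ℤ²` taking `(1, 0)` to `d` (complex multiplication by `d`); for a unit vector `d` it preserves boxes,
interiors and unit steps, and `ψ ∘ rotBy d` is a chart whenever `ψ` is. -/
def rotBy (d a : ℤ × ℤ) : ℤ × ℤ := (a.1 * d.1 - a.2 * d.2, a.1 * d.2 + a.2 * d.1)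

/-- The neighbour finset of `u` read off the edge list: the other endpoints of the edges of `E` at `u`
(`degOf E σ τ u` of them at most; every `graphOf`-neighbour of `u` is in it). -/
def nbrs (E : Finset ℕ) (σ τ : ℕ → ℕ) (u : ℕ) : Finset ℕ :=
  (E.filter fun e => σ e = u ∨ τ e = u).image fun e => if σ e = u then τ e else σ e

/-- **Germs at a cone `c`, re-grown** (`R = k/4`): the vertices obtained from a pair `(n, y)`, `n` a neighbour of `c`,
`y` a neighbour of `n`, by going straight `R - 1` steps (tip germs), together with the neighbours of the vertices obtained
from a pair `(c, n)` by going straight `R - 1` steps (side germs). Stub `stub_shellGerm`: every vertex at distance exactly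
`R + 1` from the cone `c` is such a germ; stub `stub_germCount`: there are at most `50` of them. -/
def germSet (E : Finset ℕ) (σ τ : ℕ → ℕ) (R : ℕ) (c : ℕ) : Finset ℕ :=
  ((nbrs E σ τ c).biUnion fun n =>
      (nbrs E σ τ n).image fun y => (straightIter (graphOf E σ τ) (R - 1) (n, y)).2) ∪
    (nbrs E σ τ c).biUnion fun n => nbrs E σ τ (straightIter (graphOf E σ τ) (R - 1) (c, n)).2

/-- **Opposite-neighbour rigidity** of a chart `ψ` of radius `R`: the neighbour of `ψ q` opposite to `ψ (q + e₁)` is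
`ψ (q - e₁)` and no other vertex, whenever `q`, `q - e₁`, `q - 2e₁`, `q - e₁ ± e₂` are interior
(`3 - R ≤ q.1 ≤ R - 1`, `|q.2| ≤ R - 2`). (Consequence of `IsChart`: stub `stub_opposite`; the other three directions
follow by applying it to `ψ ∘ rotBy d`.) -/
def OppRigid (Γ : SimpleGraph ℕ) (R : ℤ) (ψ : ℤ × ℤ → ℕ) : Prop :=
  ∀ q : ℤ × ℤ, 3 - R ≤ q.1 → q.1 ≤ R - 1 → |q.2| ≤ R - 2 →
    ∀ u : ℕ, IsOpposite Γ (ψ (q.1 + 1, q.2)) (ψ q) u ↔ u = ψ (q.1 - 1, q.2)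

/-! ## §3 Destructuring lemmas -/

section Access

variable {k j : ℕ} {V E Q : Finset ℕ} {σ τ : ℕ → ℕ} {bd : ℕ → Fin 4 → ℕ × Bool} {cV : ℕ → ℤ × ℤ → ℕ}
  {cE : ℕ → ℤ × ℤ → Fin 2 → ℕ × Bool}

/-- Axiom 1 of `Adm`: edges have distinct endpoints in `V`. -/
theorem Adm.edges (hA : Adm k j V E Q σ τ bd cV cE) : ∀ e ∈ E, σ e ∈ V ∧ τ e ∈ V ∧ σ e ≠ τ e := hA.1

/-- Axiom 2 of `Adm`: squares have boundary edges in `E`, consecutive, with injective vertex cycle. -/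
theorem Adm.squares (hA : Adm k j V E Q σ τ bd cV cE) :
    ∀ q ∈ Q, (∀ i, (bd q i).1 ∈ E) ∧
      (∀ i, (fun e : ℕ × Bool => if e.2 then τ e.1 else σ e.1) (bd q i) =
        (fun e : ℕ × Bool => if e.2 then σ e.1 else τ e.1) (bd q (i + 1))) ∧
      ((fun e : ℕ × Bool => if e.2 then σ e.1 else τ e.1) ∘ bd q).Injective := hA.2.1

/-- Axiom 3 of `Adm`: every edge lies in exactly two squares. -/
theorem Adm.two_squares (hA : Adm k j V E Q σ τ bd cV cE) :
    ∀ e ∈ E, (Q.filter fun q => ∃ i, (bd q i).1 = e).card = 2 := hA.2.2.1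

/-- Axiom 4 of `Adm`: degrees are `4` or `5` and the number of squares at a vertex is its degree. -/
theorem Adm.degree (hA : Adm k j V E Q σ τ bd cV cE) :
    ∀ x ∈ V, (degOf E σ τ x = 4 ∨ degOf E σ τ x = 5) ∧
      (Q.filter fun q => ∃ i, (fun e : ℕ × Bool => if e.2 then σ e.1 else τ e.1) (bd q i) = x).card =
        degOf E σ τ x := hA.2.2.2.1

/-- Axiom 5 of `Adm`: cones are `k`-dense (in the junk-valued `SimpleGraph.dist`). -/
theorem Adm.dense (hA : Adm k j V E Q σ τ bd cV cE) :
    ∀ x ∈ V, ∃ c ∈ conesOf V E σ τ, (graphOf E σ τ).dist x c ≤ k := hA.2.2.2.2.1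

/-- Axiom 6 of `Adm`: distinct cones are at distance `≥ k`. -/
theorem Adm.separated (hA : Adm k j V E Q σ τ bd cV cE) :
    ∀ c ∈ conesOf V E σ τ, ∀ c' ∈ conesOf V E σ τ, c ≠ c' → k ≤ (graphOf E σ τ).dist c c' := hA.2.2.2.2.2.1

/-- Axiom 8 of `Adm`: two deep vertices at distance `≥ j`. -/
theorem Adm.deep (hA : Adm k j V E Q σ τ bd cV cE) :
    ∃ x y, IsDeepAt k V E σ τ x ∧ IsDeepAt k V E σ τ y ∧ j ≤ (graphOf E σ τ).dist x y := hA.2.2.2.2.2.2.2.1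

/-- Axiom 9 of `Adm`, centre: the chart at a flat vertex is centred there. -/
theorem Adm.chart_center (hA : Adm k j V E Q σ τ bd cV cE) {x : ℕ} (hx : IsFlatAt k V E σ τ x) :
    cV x (0, 0) = x := (hA.2.2.2.2.2.2.2.2 x hx).1

/-- Axiom 9 of `Adm`, vertices: chart points of the box are vertices of `V`. -/
theorem Adm.chart_mem (hA : Adm k j V E Q σ τ bd cV cE) {x : ℕ} (hx : IsFlatAt k V E σ τ x) :
    ∀ a : ℤ × ℤ, InBox ((k : ℤ) / 4) a → cV x a ∈ V := (hA.2.2.2.2.2.2.2.2 x hx).2.1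

/-- Axiom 9 of `Adm`, injectivity of the chart on the box. -/
theorem Adm.chart_injOn (hA : Adm k j V E Q σ τ bd cV cE) {x : ℕ} (hx : IsFlatAt k V E σ τ x) :
    Set.InjOn (cV x) {a | InBox ((k : ℤ) / 4) a} := (hA.2.2.2.2.2.2.2.2 x hx).2.2.1

/-- Axiom 9 of `Adm`, edges: lattice edges of the box are edges of `E` with the displayed start/end points
(`μ = 0`: to `(a.1+1, a.2)`; `μ = 1`: to `(a.1, a.2+1)`; the flag `(cE x a μ).2` records the orientation). -/
theorem Adm.chart_edge (hA : Adm k j V E Q σ τ bd cV cE) {x : ℕ} (hx : IsFlatAt k V E σ τ x) :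
    ∀ (a : ℤ × ℤ) (μ : Fin 2), InBox ((k : ℤ) / 4) a →
      InBox ((k : ℤ) / 4) (if μ = 0 then (a.1 + 1, a.2) else (a.1, a.2 + 1)) →
      (cE x a μ).1 ∈ E ∧ (if (cE x a μ).2 then σ (cE x a μ).1 else τ (cE x a μ).1) = cV x a ∧
        (if (cE x a μ).2 then τ (cE x a μ).1 else σ (cE x a μ).1) =
          cV x (if μ = 0 then (a.1 + 1, a.2) else (a.1, a.2 + 1)) := (hA.2.2.2.2.2.2.2.2 x hx).2.2.2.1

/-- Axiom 9 of `Adm`, squares: unit lattice squares of the box are squares of `Q` with the displayed edge sets. -/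
theorem Adm.chart_square (hA : Adm k j V E Q σ τ bd cV cE) {x : ℕ} (hx : IsFlatAt k V E σ τ x) :
    ∀ a : ℤ × ℤ, InBox ((k : ℤ) / 4) a → InBox ((k : ℤ) / 4) (a.1 + 1, a.2 + 1) →
      ∃ q ∈ Q, Finset.univ.image (Prod.fst ∘ bd q) =
        {(cE x a 0).1, (cE x (a.1 + 1, a.2) 1).1, (cE x (a.1, a.2 + 1) 0).1, (cE x a 1).1} := by
  intro a ha ha'
  simpa using (hA.2.2.2.2.2.2.2.2 x hx).2.2.2.2 a ha ha'

/-- **A cone is never an interior chart point**: in an admissible complex, the chart image of an interior box point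
(`InBox ((k:ℤ)/4 - 1)`) at a flat vertex does not have degree `5` — the landed
`Negative.card_edgesAt_ne_five_of_boxChart` (p148625) instantiated from `Adm` by destructuring. -/
theorem Adm.degOf_chart_ne_five (hA : Adm k j V E Q σ τ bd cV cE) {x : ℕ} (hx : IsFlatAt k V E σ τ x)
    {a : ℤ × ℤ} (ha : InBox ((k : ℤ) / 4 - 1) a) : degOf E σ τ (cV x a) ≠ 5 := by
  have h := Summit.QuantumFields.YangMills.Theorems.HyperbolicToTorus.Negative.card_edgesAt_ne_five_of_boxChart
    (σ := σ) (τ := τ) (E := E) (Q := Q) (bd := bd)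
    (st := fun e : ℕ × Bool => if e.2 then σ e.1 else τ e.1)
    (en := fun e : ℕ × Bool => if e.2 then τ e.1 else σ e.1)
    (nx := fun (a : ℤ × ℤ) (μ : Fin 2) => if μ = 0 then (a.1 + 1, a.2) else (a.1, a.2 + 1))
    (fun e => by by_cases h : e.2 <;> simp [h, Finset.pair_comm]) (fun _ => rfl) (fun _ => rfl)
    hA.squares hA.two_squares ((k : ℤ) / 4) (cV x) (cE x) (hA.chart_injOn hx)
    (fun a μ ha hb => hA.chart_edge hx a μ ha hb) (fun a ha hb => (hA.2.2.2.2.2.2.2.2 x hx).2.2.2.2 a ha hb)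
    a ha.1 ha.2
  simpa [degOf] using h

/-- The cone of a cone frame is a cone (first component). -/
theorem ConeFrame.cone_mem {c x : ℕ} (h : ConeFrame k V E σ τ c x) : c ∈ conesOf V E σ τ := h.1

end Access

section Nbrs

variable {E : Finset ℕ} {σ τ : ℕ → ℕ}

/-- Adjacency in `graphOf E σ τ` unfolded (`SimpleGraph.fromRel`). -/
theorem graphOf_adj {a b : ℕ} :
    (graphOf E σ τ).Adj a b ↔ a ≠ b ∧ ((∃ e ∈ E, σ e = a ∧ τ e = b) ∨ ∃ e ∈ E, σ e = b ∧ τ e = a) := by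
  simp [graphOf, SimpleGraph.fromRel_adj]

/-- Every `graphOf`-neighbour of `u` lies in `nbrs E σ τ u`. -/
theorem mem_nbrs_of_adj {u w : ℕ} (h : (graphOf E σ τ).Adj u w) : w ∈ nbrs E σ τ u := by
  classical
  rw [graphOf_adj] at h
  obtain ⟨hne, ⟨e, heE, hs, ht⟩ | ⟨e, heE, hs, ht⟩⟩ := h
  · refine Finset.mem_image.2 ⟨e, Finset.mem_filter.2 ⟨heE, Or.inl hs⟩, ?_⟩
    simp [hs, ht]
  · refine Finset.mem_image.2 ⟨e, Finset.mem_filter.2 ⟨heE, Or.inr ht⟩, ?_⟩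
    have hσ : σ e ≠ u := by rw [hs]; exact fun h => hne h.symm
    rw [if_neg hσ, hs]

/-- `nbrs E σ τ u` has at most `degOf E σ τ u` elements. -/
theorem card_nbrs_le (u : ℕ) : (nbrs E σ τ u).card ≤ degOf E σ τ u := by
  classical
  unfold nbrs degOf
  convert Finset.card_image_le using 2

end Nbrs


section GermCount

variable {k j : ℕ} {V E Q : Finset ℕ} {σ τ : ℕ → ℕ} {bd : ℕ → Fin 4 → ℕ × Bool} {cV : ℕ → ℤ × ℤ → ℕ}
  {cE : ℕ → ℤ × ℤ → Fin 2 → ℕ × Bool}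

/-- In an admissible complex every vertex has at most five `nbrs` (degree `≤ 5` on `V`, no edges off `V`). -/
theorem Adm.card_nbrs_le_five (hA : Adm k j V E Q σ τ bd cV cE) (u : ℕ) : (nbrs E σ τ u).card ≤ 5 := by
  classical
  refine (card_nbrs_le u).trans ?_
  by_cases hu : u ∈ V
  · rcases (hA.degree u hu).1 with h | h <;> simp [h]
  · have h0 : degOf E σ τ u = 0 := by
      unfold degOf
      rw [Finset.card_eq_zero, Finset.filter_eq_empty_iff]
      rintro e he (h | h)
      · exact hu (h ▸ (hA.edges e he).1)
      · exact hu (h ▸ (hA.edges e he).2.1)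
    simp [h0]

end GermCount

/-- **Registered stub GERM COUNT** of the skeleton `Lines/no_admissible_complex.lean` v3: `#germSet E σ τ (k/4) c ≤ 50` in
an admissible complex — tip germs `≤ 5 · 5` and side germs `≤ 5 · 5` by `Adm.card_nbrs_le_five`, `Finset.card_biUnion_le`,
`Finset.card_image_le`, `Finset.card_union_le`. -/
theorem stub_germCount :
    ∀ (k j : ℕ) (V E Q : Finset ℕ) (σ τ : ℕ → ℕ) (bd : ℕ → Fin 4 → ℕ × Bool) (cV : ℕ → ℤ × ℤ → ℕ) (cE : ℕ → ℤ × ℤ → Fin 2 → ℕ × Bool), 8 ≤ k → Adm k j V E Q σ τ bd cV cE → ∀ c : ℕ, (germSet E σ τ (k / 4) c).card ≤ 50 := by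
  classical
  intro k j V E Q σ τ bd cV cE _ hA c
  have h5 := hA.card_nbrs_le_five
  unfold germSet
  refine (Finset.card_union_le _ _).trans ?_
  have hA25 : ((nbrs E σ τ c).biUnion fun n =>
      (nbrs E σ τ n).image fun y => (straightIter (graphOf E σ τ) (k / 4 - 1) (n, y)).2).card ≤ 25 := by
    refine Finset.card_biUnion_le.trans ?_
    refine (Finset.sum_le_card_nsmul _ _ 5 fun n _ => Finset.card_image_le.trans (h5 n)).trans ?_
    rw [smul_eq_mul]
    have := h5 c
    omega
  have hB25 : ((nbrs E σ τ c).biUnion fun n =>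
      nbrs E σ τ (straightIter (graphOf E σ τ) (k / 4 - 1) (c, n)).2).card ≤ 25 := by
    refine Finset.card_biUnion_le.trans ?_
    refine (Finset.sum_le_card_nsmul _ _ 5 fun n _ => h5 _).trans ?_
    rw [smul_eq_mul]
    have := h5 c
    omega
  omega

end Summit.QuantumFields.YangMills.Cruxes.HyperbolicToTorus.NoAdmissibleComplex

end
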